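/-
Origin: expansion seat `planner-pub-hodgecm-pv15-g2-0`, handover #4 v3 2026-08-18T06:58:23Z (`HOME/pub-hodgecm-pv15-g2/lean/Pv15g2/KernelThetaCarrier.lean`, md5 74d19f8e, 242 lines);
landed by the gen-7 packager in gate run 25 as `HodgeCM/Automorphic/KernelThetaCarrier.lean` (import ^import Pv15g2\.→import HodgeCM.Automorphic. ×1).
-/
/-
Origin: HOME/pub-hodgecm-pv15-g2/lean/Pv15g2/KernelThetaCarrier.lean — session planner-pub-hodgecm-pv15-g2-0
(unit pub-hodgecm-pv15-g2, DAG-NODE PROVER #15 gen 2; lineage N23a).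
Intended final place (packager's call): `HodgeCM/Automorphic/KernelThetaCarrier.lean`.
NEW, ADDITIVE; imports `HodgeCM.Automorphic.KernelCarrier` (this hand-over) only.  KIND: KERNEL + END STATE —
nothing cited, nothing posited; `#print axioms` of every declaration: `[propext, Classical.choice, Quot.sound]`.
-/
import Summits.HodgeConjecture.HodgeCM.Automorphic.KernelCarrier

/-!
# The universe-indexed theta carrier in the kernel model, and the COR-CM end state over it

`Universe.KernelThetaCarrier U` = run 24's `U.RegThetaCarrier` with `C([G_U])`, `𝒯_Φ`, `ϑ_{T,χ}` DEFINED from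
per-context kernel-model data (`KernelCoreCarrier`, `KernelTorusCarrier`): the compact space `X_U = [G_U]` of `V`,
the theta-kernel family `θ : 𝒮^κ → C(X_U × (G ⧸ Γ), ℂ)`, and a bounded inclusion `C(X_U, ℂ) → L²([G_U])` (data).

`AnalyticKer μG` — what is ASSUMED per seesaw context in this model: the structural cocompact Haar model of
`(Γ, μQ)` (run 24), the unit law `ω(1) = id`, the continuity of `Φ ↦ θ_Φ` and the Weil-action equivariance
`θ_{ω(h)Φ}(g, q) = θ_Φ(g, h⁻¹ • q)` of the kernel (structural, PerL l. 414), and THREE named analytic propositions: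
`hatτ_complete` and `AX8_annihilation` on each torus side.  `toAnalyticC` derives run 24's ten-proposition record
`RegThetaCarrier.AnalyticC`: `AX5b_ϑ_cont` ×2, `AX12_transl_cont` ×2 and the unfolded pairing (U) `AX12_unfold` ×2
are THEOREMS here (`KernelTorusCarrier.AX5b_holds`, `.AX12_transl_cont_holds`, `.AX12_unfold_holds`).

END STATE `Assembly.COR_CM_endState_ofKernelCarrier`.
-/

set_option autoImplicit false

noncomputable section

open MeasureTheory Set Filter Function
open scoped InnerProductSpace

namespace HodgeCM

namespace Universe

open HodgeCM.Prior.Perl34File HodgeCM.Prior.Perl34File.Perl34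

variable (U : Universe)

/-- **The kernel-model theta carrier** (prop-free): run 24's `U.RegThetaCarrier` WITHOUT the family `CG` and
WITHOUT the core/torus fields `TΦc`, `ϑc` (defined), WITH the per-`V` compact space `X_U = [G_U]` and the per-context
kernel-model carriers (whose `inclCG : C(X_U, ℂ) →L[ℂ] HG` is data). -/
structure KernelThetaCarrier where
  /-- `[G_U] = G_U(ℚ)\G_U(𝔸)`, a compact space -/
  XU : ∀ (L : CMField) (ι₁ : L →+* ℂ), HermSpace3 L ι₁ → Type
  [instXU₁ : ∀ L ι₁ V, TopologicalSpace (XU L ι₁ V)]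
  [instXU₂ : ∀ L ι₁ V, CompactSpace (XU L ι₁ V)]
  /-- `L²([G_U])` (or its discrete part), a Hilbert space -/
  HG : ∀ (L : CMField) (ι₁ : L →+* ℂ), HermSpace3 L ι₁ → Type
  [instHG₁ : ∀ L ι₁ V, NormedAddCommGroup (HG L ι₁ V)]
  [instHG₂ : ∀ L ι₁ V, InnerProductSpace ℂ (HG L ι₁ V)]
  [instHG₃ : ∀ L ι₁ V, CompleteSpace (HG L ι₁ V)]
  /-- degree-two classes of `P_Γ` as `L²` functions on `[G_U]` -/
  emb : ∀ {L : CMField} {ι₁ : L →+* ℂ} {V : HermSpace3 L ι₁} (Γ : Level V),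
    U.CohC (U.pms L ι₁ V Γ) 2 →ₗ[ℂ] HG L ι₁ V
  /-- the covering `P_{Γ'} → P_Γ` for `Γ' ≤ Γ` -/
  cover : ∀ {L : CMField} {ι₁ : L →+* ℂ} {V : HermSpace3 L ι₁} (Γ Γ' : Level V),
    Γ'.Γ ≤ Γ.Γ → U.Mor (U.pms L ι₁ V Γ') (U.pms L ι₁ V Γ)
  /-- sign recipe, first half -/
  kappa : ∀ (K L : CMField), (K →+* L) → (L →+* ℂ) → (L →+* ℂ) → (K →+* ℂ)
  /-- sign recipe, second half -/
  frameSign : ∀ (L : CMField), (L →+* ℂ) → (L →+* ℂ) → Bool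
  /-- `U(W)(𝔸)` -/
  G : ∀ {L : CMField} {ι₁ : L →+* ℂ}, HermSpace3 L ι₁ → SeesawCtx L → Type
  /-- `𝒮^κ` -/
  SK : ∀ {L : CMField} {ι₁ : L →+* ℂ}, HermSpace3 L ι₁ → SeesawCtx L → Type
  /-- index type of the isotypic decomposition of `L²([G_U])` -/
  SigIdxG : ∀ {L : CMField} {ι₁ : L →+* ℂ}, HermSpace3 L ι₁ → SeesawCtx L → Type
  [instG₁ : ∀ {L : CMField} {ι₁ : L →+* ℂ} (V : HermSpace3 L ι₁) (c : SeesawCtx L), Group (G V c)]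
  [instG₂ : ∀ {L : CMField} {ι₁ : L →+* ℂ} (V : HermSpace3 L ι₁) (c : SeesawCtx L), TopologicalSpace (G V c)]
  [instG₃ : ∀ {L : CMField} {ι₁ : L →+* ℂ} (V : HermSpace3 L ι₁) (c : SeesawCtx L), IsTopologicalGroup (G V c)]
  [instG₄ : ∀ {L : CMField} {ι₁ : L →+* ℂ} (V : HermSpace3 L ι₁) (c : SeesawCtx L), T2Space (G V c)]
  [instG₅ : ∀ {L : CMField} {ι₁ : L →+* ℂ} (V : HermSpace3 L ι₁) (c : SeesawCtx L), LocallyCompactSpace (G V c)]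
  [instG₆ : ∀ {L : CMField} {ι₁ : L →+* ℂ} (V : HermSpace3 L ι₁) (c : SeesawCtx L), MeasurableSpace (G V c)]
  [instG₇ : ∀ {L : CMField} {ι₁ : L →+* ℂ} (V : HermSpace3 L ι₁) (c : SeesawCtx L), BorelSpace (G V c)]
  [instSK : ∀ {L : CMField} {ι₁ : L →+* ℂ} (V : HermSpace3 L ι₁) (c : SeesawCtx L), TopologicalSpace (SK V c)]
  /-- `U(W)(L₀)`, a discrete closed cocompact subgroup of `U(W)(𝔸)` -/
  Gam : ∀ {L : CMField} {ι₁ : L →+* ℂ} (V : HermSpace3 L ι₁) (c : SeesawCtx L), Subgroup (G V c)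
  [instΓ₁ : ∀ {L : CMField} {ι₁ : L →+* ℂ} (V : HermSpace3 L ι₁) (c : SeesawCtx L), DiscreteTopology (Gam V c)]
  [instΓ₂ : ∀ {L : CMField} {ι₁ : L →+* ℂ} (V : HermSpace3 L ι₁) (c : SeesawCtx L),
    IsClosed ((Gam V c : Subgroup (G V c)) : Set (G V c))]
  [instQ₁ : ∀ {L : CMField} {ι₁ : L →+* ℂ} (V : HermSpace3 L ι₁) (c : SeesawCtx L),
    MeasurableSpace (G V c ⧸ Gam V c)]
  [instQ₂ : ∀ {L : CMField} {ι₁ : L →+* ℂ} (V : HermSpace3 L ι₁) (c : SeesawCtx L),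
    BorelSpace (G V c ⧸ Gam V c)]
  [instQ₃ : ∀ {L : CMField} {ι₁ : L →+* ℂ} (V : HermSpace3 L ι₁) (c : SeesawCtx L),
    CompactSpace (G V c ⧸ Gam V c)]
  /-- the invariant (finite) measure of `[U(W)] = U(W)(L₀)\U(W)(𝔸)` (realised on `G ⧸ Γ`) -/
  μQ : ∀ {L : CMField} {ι₁ : L →+* ℂ} (V : HermSpace3 L ι₁) (c : SeesawCtx L), Measure (G V c ⧸ Gam V c)
  [instμ₁ : ∀ {L : CMField} {ι₁ : L →+* ℂ} (V : HermSpace3 L ι₁) (c : SeesawCtx L),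
    SMulInvariantMeasure (G V c) (G V c ⧸ Gam V c) (μQ V c)]
  [instμ₂ : ∀ {L : CMField} {ι₁ : L →+* ℂ} (V : HermSpace3 L ι₁) (c : SeesawCtx L), IsFiniteMeasure (μQ V c)]
  /-- `T₁₂(𝔸)` -/
  T12 : ∀ {L : CMField} {ι₁ : L →+* ℂ}, HermSpace3 L ι₁ → SeesawCtx L → Type
  /-- `T₃₄(𝔸)` -/
  T34 : ∀ {L : CMField} {ι₁ : L →+* ℂ}, HermSpace3 L ι₁ → SeesawCtx L → Type
  [instT12₁ : ∀ {L : CMField} {ι₁ : L →+* ℂ} (V : HermSpace3 L ι₁) (c : SeesawCtx L), Group (T12 V c)]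
  [instT12₂ : ∀ {L : CMField} {ι₁ : L →+* ℂ} (V : HermSpace3 L ι₁) (c : SeesawCtx L), TopologicalSpace (T12 V c)]
  [instT12₃ : ∀ {L : CMField} {ι₁ : L →+* ℂ} (V : HermSpace3 L ι₁) (c : SeesawCtx L), T2Space (T12 V c)]
  [instT12₄ : ∀ {L : CMField} {ι₁ : L →+* ℂ} (V : HermSpace3 L ι₁) (c : SeesawCtx L), MeasurableSpace (T12 V c)]
  [instT12₅ : ∀ {L : CMField} {ι₁ : L →+* ℂ} (V : HermSpace3 L ι₁) (c : SeesawCtx L),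
    OpensMeasurableSpace (T12 V c)]
  [instT34₁ : ∀ {L : CMField} {ι₁ : L →+* ℂ} (V : HermSpace3 L ι₁) (c : SeesawCtx L), Group (T34 V c)]
  [instT34₂ : ∀ {L : CMField} {ι₁ : L →+* ℂ} (V : HermSpace3 L ι₁) (c : SeesawCtx L), TopologicalSpace (T34 V c)]
  [instT34₃ : ∀ {L : CMField} {ι₁ : L →+* ℂ} (V : HermSpace3 L ι₁) (c : SeesawCtx L), T2Space (T34 V c)]
  [instT34₄ : ∀ {L : CMField} {ι₁ : L →+* ℂ} (V : HermSpace3 L ι₁) (c : SeesawCtx L), MeasurableSpace (T34 V c)]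
  [instT34₅ : ∀ {L : CMField} {ι₁ : L →+* ℂ} (V : HermSpace3 L ι₁) (c : SeesawCtx L),
    OpensMeasurableSpace (T34 V c)]
  /-- the kernel-model core of the context: `ω`, the theta kernels `θ_Φ`, the inclusion, `τ̂` -/
  kcore : ∀ {L : CMField} {ι₁ : L →+* ℂ} (V : HermSpace3 L ι₁) (c : SeesawCtx L),
    KernelCoreCarrier (G V c) (Gam V c) (μQ V c) (XU L ι₁ V) (HG L ι₁ V) (SK V c) (SigIdxG V c)
  /-- the (12) torus side -/
  kt12 : ∀ {L : CMField} {ι₁ : L →+* ℂ} (V : HermSpace3 L ι₁) (c : SeesawCtx L),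
    KernelTorusCarrier (kcore V c) (T12 V c)
  /-- the (34) torus side -/
  kt34 : ∀ {L : CMField} {ι₁ : L →+* ℂ} (V : HermSpace3 L ι₁) (c : SeesawCtx L),
    KernelTorusCarrier (kcore V c) (T34 V c)
  [instν12 : ∀ {L : CMField} {ι₁ : L →+* ℂ} (V : HermSpace3 L ι₁) (c : SeesawCtx L),
    IsFiniteMeasureOnCompacts (kt12 V c).ν]
  [instν34 : ∀ {L : CMField} {ι₁ : L →+* ℂ} (V : HermSpace3 L ι₁) (c : SeesawCtx L),
    IsFiniteMeasureOnCompacts (kt34 V c).ν]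
  /-- the theta one-forms of type `Ψ_i` at level `Γ` -/
  Theta : ∀ {L : CMField} {ι₁ : L →+* ℂ} (V : HermSpace3 L ι₁), SeesawCtx L → Fin 4 → ∀ Γ : Level V,
    Set (U.CohC (U.pms L ι₁ V Γ) 1)

attribute [instance] KernelThetaCarrier.instXU₁ KernelThetaCarrier.instXU₂ KernelThetaCarrier.instHG₁
  KernelThetaCarrier.instHG₂ KernelThetaCarrier.instHG₃
  KernelThetaCarrier.instG₁ KernelThetaCarrier.instG₂ KernelThetaCarrier.instG₃ KernelThetaCarrier.instG₄
  KernelThetaCarrier.instG₅ KernelThetaCarrier.instG₆ KernelThetaCarrier.instG₇ KernelThetaCarrier.instSK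
  KernelThetaCarrier.instΓ₁ KernelThetaCarrier.instΓ₂ KernelThetaCarrier.instQ₁ KernelThetaCarrier.instQ₂
  KernelThetaCarrier.instQ₃ KernelThetaCarrier.instμ₁ KernelThetaCarrier.instμ₂
  KernelThetaCarrier.instT12₁ KernelThetaCarrier.instT12₂ KernelThetaCarrier.instT12₃ KernelThetaCarrier.instT12₄
  KernelThetaCarrier.instT12₅ KernelThetaCarrier.instT34₁ KernelThetaCarrier.instT34₂ KernelThetaCarrier.instT34₃
  KernelThetaCarrier.instT34₄ KernelThetaCarrier.instT34₅ KernelThetaCarrier.instν12 KernelThetaCarrier.instν34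

namespace KernelThetaCarrier

variable {U} (D : U.KernelThetaCarrier)

/-- **The regular-model carrier of a kernel-model one**: `C([G_U]) := C(X_U, ℂ)`, cores and torus sides converted
(`𝒯_Φ`, `ϑ_{T,χ}` defined).  Reducible, for instance search. -/
abbrev toRegThetaCarrier : U.RegThetaCarrier where
  HG := D.HG
  emb := D.emb
  cover := D.cover
  kappa := D.kappa
  frameSign := D.frameSign
  CG := fun {L} {ι₁} V _ => C(D.XU L ι₁ V, ℂ)
  G := D.G
  SK := D.SK
  SigIdxG := D.SigIdxG
  Gam := D.Gam
  μQ := D.μQ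
  T12 := D.T12
  T34 := D.T34
  core := fun V c => (D.kcore V c).toRegCoreCarrier
  t12 := fun V c => (D.kt12 V c).toRegTorusCarrier
  t34 := fun V c => (D.kt34 V c).toRegTorusCarrier
  Theta := D.Theta

/-- **What is ASSUMED per seesaw context in the kernel model**, over a family `μG` of measures on the groups
`U(W)(𝔸)`: STRUCTURAL — the cocompact Haar model of `(Γ, μQ)`, the unit law of `ω`, the continuity of `Φ ↦ θ_Φ`,
the Weil-action equivariance of the kernel (l. 414); ANALYTIC (three named propositions) — `hatτ_complete` and
`AX8_annihilation` on each torus side. -/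
structure AnalyticKer (μG : ∀ {L : CMField} {ι₁ : L →+* ℂ} (V : HermSpace3 L ι₁) (c : SeesawCtx L),
    Measure (D.G V c)) : Prop where
  /-- structural: `[U(W)]` compact, `μQ` the Haar quotient measure (ll. 384–385) -/
  cocompact : ∀ {L : CMField} {ι₁ : L →+* ℂ} (V : HermSpace3 L ι₁) (c : SeesawCtx L),
    RegularRep.IsCocompactHaarModel (D.Gam V c) (D.μQ V c) (μG V c)
  /-- structural: the unit law of the Weil representation `ω` -/
  omg_one : ∀ {L : CMField} {ι₁ : L →+* ℂ} (V : HermSpace3 L ι₁) (c : SeesawCtx L) (Φ : D.SK V c),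
    (D.kcore V c).omg 1 Φ = Φ
  /-- structural: `Φ ↦ θ_Φ` is continuous `𝒮^κ → C([G_U] × [U(W)])` -/
  θ_cont : ∀ {L : CMField} {ι₁ : L →+* ℂ} (V : HermSpace3 L ι₁) (c : SeesawCtx L), Continuous (D.kcore V c).θ
  /-- structural: the Weil-action equivariance `θ_{ω(h)Φ}(g, q) = θ_Φ(g, h⁻¹ • q)` (tex l. 414) -/
  θ_omg : ∀ {L : CMField} {ι₁ : L →+* ℂ} (V : HermSpace3 L ι₁) (c : SeesawCtx L) (h : D.G V c) (Φ : D.SK V c)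
    (ξ : D.XU L ι₁ V) (q : D.G V c ⧸ D.Gam V c),
    (D.kcore V c).θ ((D.kcore V c).omg h Φ) (ξ, q) = (D.kcore V c).θ Φ (ξ, h⁻¹ • q)
  /-- analytic: the `G_U`-side isotypic pieces `τ̂` exhaust `L²([G_U])` -/
  hatτ_complete : ∀ {L : CMField} {ι₁ : L →+* ℂ} (V : HermSpace3 L ι₁) (c : SeesawCtx L),
    (⨆ j, (D.kcore V c).hatτ j).topologicalClosure = ⊤
  /-- analytic: AX8 on the (12) side -/
  t12 : ∀ {L : CMField} {ι₁ : L →+* ℂ} (V : HermSpace3 L ι₁) (c : SeesawCtx L), (D.kt12 V c).AnalyticK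
  /-- analytic: AX8 on the (34) side -/
  t34 : ∀ {L : CMField} {ι₁ : L →+* ℂ} (V : HermSpace3 L ι₁) (c : SeesawCtx L), (D.kt34 V c).AnalyticK

variable {D}
variable {μG : ∀ {L : CMField} {ι₁ : L →+* ℂ} (V : HermSpace3 L ι₁) (c : SeesawCtx L), Measure (D.G V c)}

/-- **Run 24's ten-proposition record from the kernel model** (`AX5b_ϑ_cont`, `AX12_transl_cont`, `AX12_unfold` on
both torus sides are theorems). -/
theorem AnalyticKer.toAnalyticC (hA : D.AnalyticKer μG) : D.toRegThetaCarrier.AnalyticC μG where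
  cocompact := hA.cocompact
  hatτ_complete := hA.hatτ_complete
  omg_one := hA.omg_one
  t12 := fun V c => (hA.t12 V c).toAnalyticU (hA.cocompact V c) (hA.θ_cont V c) (hA.θ_omg V c)
  t34 := fun V c => (hA.t34 V c).toAnalyticU (hA.cocompact V c) (hA.θ_cont V c) (hA.θ_omg V c)

/-- … hence gen 3's fifteen. -/
theorem AnalyticKer.toAnalytic (hA : D.AnalyticKer μG) : D.toRegThetaCarrier.Analytic :=
  hA.toAnalyticC.toAnalytic

end KernelThetaCarrier

end Universe

/-! ## END STATE -/

namespace Assembly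

open HodgeCM.Prior.Perl34File HodgeCM.Prior.Perl34File.Perl34
open HodgeCM.Universe (KernelThetaCarrier ThetaModel)

variable (U : Universe)

/-- **PerL over a kernel-model carrier.** -/
theorem perL_ofKernelCarrier (M : U.ModelAxioms) (D : U.KernelThetaCarrier)
    {μG : ∀ {L : CMField} {ι₁ : L →+* ℂ} (V : HermSpace3 L ι₁) (c : SeesawCtx L), Measure (D.G V c)}
    (hA : D.AnalyticKer μG) (A : (ThetaModel.ofRegCarrier D.toRegThetaCarrier hA.toAnalytic).Inputs)
    (hHR : U.Fact_hodgeRiemann20) : U.PerL :=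
  perL_ofRegCarrierC U M D.toRegThetaCarrier hA.toAnalyticC A hHR

/-- **COR-CM, END STATE over a kernel-model carrier**: per seesaw context the structural data (cocompact Haar model,
`ω(1) = id`, continuity and Weil-equivariance of the theta kernels) and THREE named analytic propositions
(`hatτ_complete`; `AX8_annihilation` on each torus side); the model facts, the ten theta inputs, Hodge–Riemann,
and the QW8 facts.  Of the gen-2 carrier's propositions, `R_unitary`, `discreteDecomp`, `AX12_E_transl` ×2,
`AX5b_ϑ_cont` ×2, `AX12_transl_cont` ×2, the unfolded pairing (U) ×2 with its consequences `AX12_unfold_lift` ×2,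
`AX12_molly` ×2, and `AX9_w_vector` ×2 are THEOREMS in this model. -/
theorem COR_CM_endState_ofKernelCarrier (M : U.ModelAxioms) (h29 : U.Fact_weightSpan) (h30 : U.Fact_weightHodge)
    (hE : U.Qw8ExtProd) (hD : U.Qw8DualPushPull) (hMi : U.Qw8Milne) (D : U.KernelThetaCarrier)
    {μG : ∀ {L : CMField} {ι₁ : L →+* ℂ} (V : HermSpace3 L ι₁) (c : SeesawCtx L), Measure (D.G V c)}
    (hA : D.AnalyticKer μG) (A : (ThetaModel.ofRegCarrier D.toRegThetaCarrier hA.toAnalytic).Inputs)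
    (hHR : U.Fact_hodgeRiemann20) : U.HC_CM :=
  COR_CM_endState_ofRegCarrierC U M h29 h30 hE hD hMi D.toRegThetaCarrier hA.toAnalyticC A hHR

end Assembly

end HodgeCM

end
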